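import Summits.AtomisticToContinuum.FouriersLaw.Theses.VanishingNoiseTransfer
import Literature.MathematicalPhysics.KineticTheory.VelocityFlipNoise
import Literature.MathematicalPhysics.KineticTheory.LangevinChainGibbs

/-!
# Sketch — crux-ideate round 2, ideator 4 (crux `VanishingNoiseTransfer.VanishingNoiseBound`,
item stmt-AtomisticToContinuum-11976)

First lemmas (signatures; `sorry` allowed at this stage) for the two round-2 idea cards

* `even-corrector-smoluchowski` — §1: the even block of the flip hierarchy is reversible
  (`evenDirichletForm_eq_sum_sites`, `liouville_sq_position_eq_witten`,
  `hessian_le_wittenGen_sq` = the Bakry–Émery `Γ₂` / `H²` bound for the position block);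
* `parity-flow-exponent` — §2: the flip-rate flow of the Green–Kubo form
  (`parityFlow_hasDerivAt` = matrix Hellmann–Feynman + `Θ`-conjugation; `bddAbove_of_dini_flow`
  = the real-analysis glue from a Dini bound on the parity asymmetry to the crux's operational
  form `cruxAt_iff_bddAbove_kappa`).

All objects are over existing tree declarations (`OscillatorChain.hamiltonian`, `partialQ`,
`partialP`, `momentumFlip`, `OscillatorChain.gibbsMeasure`, `pinnedChain`) and Mathlib matrices.
-/

noncomputable section

open MeasureTheory Filter Topology Matrix
open scoped ContDiff BigOperators

namespace Summit.AtomisticToContinuum.FouriersLaw.Cruxes.VanishingNoiseBound.IdeasR2K4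

open Literature.MathematicalPhysics.KineticTheory.HeatConduction

variable {N : ℕ}

/-! ## §0 Objects: the Hamiltonian Liouvillian, its one-site pieces, flip-evenness -/

/-- The one-site piece `L_i f = p_i ∂_{q_i} f − ∂_{q_i}H ∂_{p_i} f` of the Hamiltonian Liouvillian
(it preserves `H`, is divergence-free, and flips the `p_i`-parity of `f`). -/
def siteLiouville (P : OscillatorChain) (N : ℕ) (i : Fin N) (f : PhaseSpace N → ℝ)
    (x : PhaseSpace N) : ℝ :=
  x.2 i * partialQ i f x - partialQ i (P.hamiltonian N) x * partialP i f x

/-- The Hamiltonian Liouvillian `A f = Σ_i L_i f` (= `P.generator` without the two bath terms). -/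
def liouville (P : OscillatorChain) (N : ℕ) (f : PhaseSpace N → ℝ) (x : PhaseSpace N) : ℝ :=
  ∑ i : Fin N, siteLiouville P N i f x

/-- `f` is FLIP-EVEN (level `0` of the flip grading): invariant under every single-site momentum
flip. The flip generator `S` vanishes exactly on these; `A` maps them into level `1`. -/
def IsFlipEven (f : PhaseSpace N → ℝ) : Prop :=
  ∀ (i : Fin N) (x : PhaseSpace N), f (momentumFlip i x) = f x

/-- The overdamped (Witten / Smoluchowski) generator of the POSITION Gibbs field at temperature
`T`: `𝓛 h = Σ_i (T ∂²_{q_i} h − ∂_{q_i}H · ∂_{q_i} h)` (for position-only `h` the momenta in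
`∂_{q_i}H` do not enter: `∂_{q_i}H = Φ'_i(q)`). -/
def wittenGen (P : OscillatorChain) (N : ℕ) (T : ℝ) (h : PhaseSpace N → ℝ) (x : PhaseSpace N) : ℝ :=
  ∑ i : Fin N, (T * partialQ i (partialQ i h) x - partialQ i (P.hamiltonian N) x * partialQ i h x)

/-! ## §1 Card `even-corrector-smoluchowski`: the even block is a reversible Dirichlet form -/

/-! ### §1a Parity engine (proved): how `∂_q`, `∂_p` and the one-site Liouvillian transform under
a single momentum flip -/

theorem partialQ_comp_momentumFlip (i j : Fin N) (f : PhaseSpace N → ℝ) (x : PhaseSpace N) :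
    partialQ j (f ∘ momentumFlip i) x = partialQ j f (momentumFlip i x) := by
  unfold partialQ
  rfl

theorem partialP_comp_momentumFlip_self (i : Fin N) (f : PhaseSpace N → ℝ) (x : PhaseSpace N) :
    partialP i (f ∘ momentumFlip i) x = -partialP i f (momentumFlip i x) := by
  unfold partialP
  set g : ℝ → ℝ := fun s => f (x.1, Function.update x.2 i s) with hg
  have h : (fun t => (f ∘ momentumFlip i) (x.1, Function.update x.2 i t)) = fun t => g (-t) := by
    funext t
    simp [hg, momentumFlip, Function.update_idem]
  have h2 : (fun s => f ((momentumFlip i x).1, Function.update (momentumFlip i x).2 i s)) = g := by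
    funext s
    simp [hg, momentumFlip, Function.update_idem]
  rw [h, h2, deriv_comp_neg]
  simp [momentumFlip]

theorem partialP_comp_momentumFlip_of_ne {i j : Fin N} (hij : j ≠ i) (f : PhaseSpace N → ℝ)
    (x : PhaseSpace N) :
    partialP j (f ∘ momentumFlip i) x = partialP j f (momentumFlip i x) := by
  unfold partialP
  have h : (fun t => (f ∘ momentumFlip i) (x.1, Function.update x.2 j t)) =
      fun t => f ((momentumFlip i x).1, Function.update (momentumFlip i x).2 j t) := by
    funext t
    simp only [Function.comp_apply, momentumFlip]
    rw [Function.update_of_ne hij.symm, Function.update_comm hij.symm]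
  rw [h]
  simp [momentumFlip, Function.update_of_ne hij]

/-- The one-site Liouvillian of a flip-EVEN observable is ODD under the flip of its own momentum. -/
theorem siteLiouville_momentumFlip_self (P : OscillatorChain) (i : Fin N) {h : PhaseSpace N → ℝ}
    (heh : IsFlipEven h) (x : PhaseSpace N) :
    siteLiouville P N i h (momentumFlip i x) = -siteLiouville P N i h x := by
  have hfun : h ∘ momentumFlip i = h := funext (heh i)
  have hH : P.hamiltonian N ∘ momentumFlip i = P.hamiltonian N :=
    funext fun y => P.hamiltonian_momentumFlip i y
  have hq : partialQ i h (momentumFlip i x) = partialQ i h x := by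
    rw [← partialQ_comp_momentumFlip i i h x, hfun]
  have hp : partialP i h (momentumFlip i x) = -partialP i h x := by
    have := partialP_comp_momentumFlip_self i h x
    rw [hfun] at this
    linarith
  have hHq : partialQ i (P.hamiltonian N) (momentumFlip i x) = partialQ i (P.hamiltonian N) x := by
    rw [← partialQ_comp_momentumFlip i i (P.hamiltonian N) x, hH]
  simp only [siteLiouville, hq, hp, hHq, momentumFlip_snd_self]
  ring

/-- The one-site Liouvillian of a flip-even observable at site `j` is EVEN under the flip of a
DIFFERENT momentum `i`. -/
theorem siteLiouville_momentumFlip_of_ne (P : OscillatorChain) {i j : Fin N} (hij : j ≠ i)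
    {k : PhaseSpace N → ℝ} (hek : IsFlipEven k) (x : PhaseSpace N) :
    siteLiouville P N j k (momentumFlip i x) = siteLiouville P N j k x := by
  have hfun : k ∘ momentumFlip i = k := funext (hek i)
  have hH : P.hamiltonian N ∘ momentumFlip i = P.hamiltonian N :=
    funext fun y => P.hamiltonian_momentumFlip i y
  have hq : partialQ j k (momentumFlip i x) = partialQ j k x := by
    rw [← partialQ_comp_momentumFlip i j k x, hfun]
  have hp : partialP j k (momentumFlip i x) = partialP j k x := by
    rw [← partialP_comp_momentumFlip_of_ne hij k x, hfun]
  have hHq : partialQ j (P.hamiltonian N) (momentumFlip i x) = partialQ j (P.hamiltonian N) x := by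
    rw [← partialQ_comp_momentumFlip i j (P.hamiltonian N) x, hH]
  simp only [siteLiouville, hq, hp, hHq, momentumFlip_snd_of_ne hij]

/-- CROSS TERMS VANISH: for flip-even `h, k` and `i ≠ j`, `∫ (L_i h)(L_j k) dμ_T = 0` against ANY
Gibbs measure of any chain (the integrand is odd under the flip of `p_i`, which preserves `μ_T`). -/
theorem integral_siteLiouville_mul_of_ne (P : OscillatorChain) (N : ℕ) (T : ℝ) {i j : Fin N}
    (hij : i ≠ j) {h k : PhaseSpace N → ℝ} (heh : IsFlipEven h) (hek : IsFlipEven k) :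
    ∫ x, siteLiouville P N i h x * siteLiouville P N j k x ∂(P.gibbsMeasure N T) = 0 := by
  have hodd : ∀ x, siteLiouville P N i h (momentumFlip i x) * siteLiouville P N j k (momentumFlip i x)
      = -(siteLiouville P N i h x * siteLiouville P N j k x) := by
    intro x
    rw [siteLiouville_momentumFlip_self P i heh, siteLiouville_momentumFlip_of_ne P hij.symm hek]
    ring
  have hmp := P.measurePreserving_momentumFlip_gibbsMeasure N T i
  have hint := hmp.integral_comp (momentumFlipEquiv i).measurableEmbedding
    (fun x => siteLiouville P N i h x * siteLiouville P N j k x)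
  simp only [coe_momentumFlipEquiv, hodd, integral_neg] at hint
  linarith


/-- **Even Dirichlet form = sum of one-site forms.** For flip-even `h, k` the cross terms
`∫ (L_i h)(L_j k) dμ_T`, `i ≠ j`, vanish by `p_i`-parity (`L_i h` is odd in `p_i` and even in
`p_j`), so `⟨A h, A k⟩_{L²(μ_T)} = Σ_i ⟨L_i h, L_i k⟩`: the quadratic form of `B*B = −(A²)₀₀` on the
even sector is a SUM OF SQUARES of one vector field per site — a reversible (symmetric Markov)
Dirichlet form, the strong-noise (Smoluchowski) limit of the flip-noisy chain. -/
theorem evenDirichletForm_eq_sum_sites (ω₂ lam β γ T : ℝ) (hω : 0 < ω₂) (hl : 0 < lam)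
    (hβ : 0 < β) (hT : 0 < T) (h k : PhaseSpace N → ℝ)
    (hh : ContDiff ℝ 1 h) (hk : ContDiff ℝ 1 k) (hhc : HasCompactSupport h)
    (hkc : HasCompactSupport k) (heh : IsFlipEven h) (hek : IsFlipEven k) :
    ∫ x, liouville (pinnedChain ω₂ lam β γ) N h x * liouville (pinnedChain ω₂ lam β γ) N k x
        ∂((pinnedChain ω₂ lam β γ).gibbsMeasure N T)
      = ∑ i : Fin N, ∫ x, siteLiouville (pinnedChain ω₂ lam β γ) N i h x *
          siteLiouville (pinnedChain ω₂ lam β γ) N i k x ∂((pinnedChain ω₂ lam β γ).gibbsMeasure N T) := by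
  set P := pinnedChain ω₂ lam β γ with hP
  haveI : IsProbabilityMeasure (P.gibbsMeasure N T) :=
    pinnedChain_isProbabilityMeasure_gibbsMeasure hω hl.le hβ.le γ N hT
  have hH1 : ContDiff ℝ 1 (P.hamiltonian N) :=
    P.contDiff_hamiltonian (pinnedChain_contDiff_U ω₂ lam β γ) (pinnedChain_contDiff_V ω₂ lam β γ) N
  -- regularity of the one-site Liouvillians: continuous with compact support
  have hreg : ∀ (f : PhaseSpace N → ℝ), ContDiff ℝ 1 f → HasCompactSupport f → ∀ i : Fin N,
      Continuous (siteLiouville P N i f) ∧ HasCompactSupport (siteLiouville P N i f) := by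
    intro f hf hfc i
    have hd : Differentiable ℝ f := hf.differentiable one_ne_zero
    refine ⟨?_, ?_⟩
    · exact (((continuous_apply i).comp continuous_snd).mul (continuous_partialQ hf one_ne_zero i)).sub
        ((P.continuous_partialQ_hamiltonian hH1 i).mul (continuous_partialP hf one_ne_zero i))
    · have h1 : HasCompactSupport (fun x : PhaseSpace N => x.2 i * partialQ i f x) :=
        (hasCompactSupport_partialQ hd hfc i).mul_left
      have h2 : HasCompactSupport
          (fun x : PhaseSpace N => partialQ i (P.hamiltonian N) x * partialP i f x) :=
        (hasCompactSupport_partialP hd hfc i).mul_left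
      exact h1.sub h2
  have hI : ∀ i j : Fin N, Integrable
      (fun x => siteLiouville P N i h x * siteLiouville P N j k x) (P.gibbsMeasure N T) := by
    intro i j
    obtain ⟨hc1, hs1⟩ := hreg h hh hhc i
    obtain ⟨hc2, hs2⟩ := hreg k hk hkc j
    exact (hc1.mul hc2).integrable_of_hasCompactSupport hs1.mul_right
  calc ∫ x, liouville P N h x * liouville P N k x ∂(P.gibbsMeasure N T)
      = ∫ x, ∑ i : Fin N, ∑ j : Fin N,
          siteLiouville P N i h x * siteLiouville P N j k x ∂(P.gibbsMeasure N T) := by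
        congr 1
        funext x
        simp only [liouville, Finset.sum_mul_sum]
    _ = ∑ i : Fin N, ∑ j : Fin N,
          ∫ x, siteLiouville P N i h x * siteLiouville P N j k x ∂(P.gibbsMeasure N T) := by
        rw [integral_finset_sum _ (fun i _ => integrable_finset_sum _ (fun j _ => hI i j))]
        exact Finset.sum_congr rfl fun i _ => integral_finset_sum _ (fun j _ => hI i j)
    _ = ∑ i : Fin N, ∫ x, siteLiouville P N i h x * siteLiouville P N i k x
          ∂(P.gibbsMeasure N T) := by
        refine Finset.sum_congr rfl fun i _ => ?_
        rw [Finset.sum_eq_single i]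
        · intro j _ hji
          exact integral_siteLiouville_mul_of_ne P N T (Ne.symm hji) heh hek
        · intro hi
          exact absurd (Finset.mem_univ i) hi

/-- **Position block = `T ×` the Witten form.** For a position-only observable `h = g ∘ Prod.fst`,
`A h = Σ_i p_i ∂_{q_i} g` and the momenta are i.i.d. `N(0,T)` under `μ_T`, independent of `q`, so
`‖A h‖²_{L²(μ_T)} = T Σ_i ‖∂_{q_i} g‖²`: on position functions the even-sector operator `B*B` IS
`T ×` the Dirichlet form of the overdamped Langevin dynamics of the uniformly log-concave position
field `e^{-Φ(q)/T} dq`, `Φ = Σ U(q_i) + Σ V(q_{i+1} − q_i)`, `Hess Φ ≥ ω₂`. -/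
theorem liouville_sq_position_eq_witten (ω₂ lam β γ T : ℝ) (hω : 0 < ω₂) (hl : 0 < lam)
    (hβ : 0 < β) (hT : 0 < T) (g : (Fin N → ℝ) → ℝ) (hg : ContDiff ℝ ∞ g)
    (hgc : HasCompactSupport g) :
    ∫ x, (liouville (pinnedChain ω₂ lam β γ) N (g ∘ Prod.fst) x) ^ 2
        ∂((pinnedChain ω₂ lam β γ).gibbsMeasure N T)
      = T * ∑ i : Fin N, ∫ x, (partialQ i (g ∘ Prod.fst) x) ^ 2
          ∂((pinnedChain ω₂ lam β γ).gibbsMeasure N T) := by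
  sorry

/-- **`H²`-regularity of the position block (integrated Bochner / Bakry–Émery `Γ₂`).** For the
uniformly convex total potential of `pinnedChain` (`U'' ≥ ω₂ > 0`, `V'' ≥ 1`), integrating
`Γ₂(h) = |∇∇h|² + (1/T)∇∇Φ(∇h,∇h)·T`-type identity (BGL (1.16.5)) against `μ_T` gives
`Σ_{i,j} ‖∂_{q_i}∂_{q_j} h‖² ≤ T⁻² ‖𝓛 h‖²`: second derivatives of the even (position) corrector are
controlled by the Witten generator — the first rung of `EvenH2` (N-uniform constant `T⁻²`). -/
theorem hessian_le_wittenGen_sq (ω₂ lam β γ T : ℝ) (hω : 0 < ω₂) (hl : 0 < lam)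
    (hβ : 0 < β) (hT : 0 < T) (g : (Fin N → ℝ) → ℝ) (hg : ContDiff ℝ ∞ g)
    (hgc : HasCompactSupport g) :
    ∑ i : Fin N, ∑ j : Fin N, ∫ x, (partialQ i (partialQ j (g ∘ Prod.fst)) x) ^ 2
        ∂((pinnedChain ω₂ lam β γ).gibbsMeasure N T)
      ≤ (1 / T ^ 2) * ∫ x, (wittenGen (pinnedChain ω₂ lam β γ) N T (g ∘ Prod.fst) x) ^ 2
          ∂((pinnedChain ω₂ lam β γ).gibbsMeasure N T) := by
  sorry

/-! ## §2 Card `parity-flow-exponent`: the flip-rate flow of the Green–Kubo form -/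

/-- **Parity flow (finite-dimensional core).** In any flip-graded model — `A` skew, `M` symmetric
(the flip level operator), `Θ` a symmetric involution commuting with `M` and anticommuting with
`A` (global momentum reversal, `Θ = (−1)^{level}`), `Θ j = −j` (the current is odd) — the
Green–Kubo form `f(ε) = j · (εM − A)⁻¹ j` satisfies the EXACT flow equation
`f'(ε) = (Θ u) · (M u)`, `u = (εM − A)⁻¹ j`, i.e. `ε f' = D_even − D_odd` and, with
`f = D_even + D_odd` (total flip dissipation), `d log f / d log ε = −α`,
`α = (D_odd − D_even)/(D_odd + D_even) ∈ [−1,1]`. (Hellmann–Feynman `dR/dε = −RMR` plus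
`Rᵀ j = −Θ R j` from `Θ(εM − A)Θ = εM + A`.) Checked numerically on random graded models
(`toys/graded_identities.py`). -/
theorem parityFlow_hasDerivAt {n : ℕ} (A M Θ : Matrix (Fin n) (Fin n) ℝ) (j : Fin n → ℝ)
    (hA : Aᵀ = -A) (hM : Mᵀ = M) (hΘ2 : Θ * Θ = 1) (hΘs : Θᵀ = Θ) (hΘM : Θ * M = M * Θ)
    (hΘA : Θ * A = -(A * Θ)) (hj : Θ *ᵥ j = -j) (ε₀ : ℝ)
    (hinv : ∀ᶠ ε in 𝓝 ε₀, IsUnit (ε • M - A).det) :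
    HasDerivAt (fun ε : ℝ => j ⬝ᵥ ((ε • M - A)⁻¹ *ᵥ j))
      ((Θ *ᵥ ((ε₀ • M - A)⁻¹ *ᵥ j)) ⬝ᵥ (M *ᵥ ((ε₀ • M - A)⁻¹ *ᵥ j))) ε₀ := by
  classical
  letI : NormedRing (Matrix (Fin n) (Fin n) ℝ) := Matrix.linftyOpNormedRing
  letI : NormedAlgebra ℝ (Matrix (Fin n) (Fin n) ℝ) := Matrix.linftyOpNormedAlgebra
  haveI : CompleteSpace (Matrix (Fin n) (Fin n) ℝ) := FiniteDimensional.complete ℝ _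
  -- the resolvent at ε₀ is a unit
  have hdet : IsUnit (ε₀ • M - A).det := hinv.self_of_nhds
  have hU : IsUnit (ε₀ • M - A) := (Matrix.isUnit_iff_isUnit_det _).mpr hdet
  obtain ⟨x, hx⟩ := hU
  set R₀ : Matrix (Fin n) (Fin n) ℝ := (ε₀ • M - A)⁻¹ with hR₀
  have hxinv : ((x⁻¹ : (Matrix (Fin n) (Fin n) ℝ)ˣ) : Matrix (Fin n) (Fin n) ℝ) = R₀ := by
    rw [hR₀, ← hx, Matrix.nonsing_inv_eq_ringInverse, Ring.inverse_unit]
  -- the linear functional X ↦ j · X j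
  let φ : Matrix (Fin n) (Fin n) ℝ →L[ℝ] ℝ := LinearMap.toContinuousLinearMap
    { toFun := fun X => j ⬝ᵥ X *ᵥ j
      map_add' := fun X Y => by simp [Matrix.add_mulVec, dotProduct_add]
      map_smul' := fun c X => by simp [Matrix.smul_mulVec, dotProduct_smul] }
  have hφ : ∀ X, φ X = j ⬝ᵥ X *ᵥ j := fun X => rfl
  -- chain rule in the (local) operator-normed matrix algebra: ε ↦ εM − A ↦ inverse ↦ φ
  have h0 := ((hasDerivAt_id' ε₀).smul_const M).sub_const A
  have h1 := hasFDerivAt_ringInverse (𝕜 := ℝ) x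
  rw [hx] at h1
  have h2 := h1.comp_hasDerivAt ε₀ h0
  have h3 := (φ.hasFDerivAt).comp_hasDerivAt ε₀ h2
  -- Θ-conjugation: R₀ᵀ = Θ R₀ Θ, hence R₀ᵀ j = −Θ R₀ j
  have hΘinv : Θ⁻¹ = Θ := Matrix.inv_eq_left_inv hΘ2
  have hconj : Θ * (ε₀ • M - A) * Θ = ε₀ • M + A := by
    calc Θ * (ε₀ • M - A) * Θ = ε₀ • (Θ * M * Θ) - Θ * A * Θ := by
            simp [Matrix.mul_sub, Matrix.sub_mul, Matrix.mul_smul, Matrix.smul_mul]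
      _ = ε₀ • (M * Θ * Θ) - (-(A * Θ) * Θ) := by rw [hΘM, hΘA]
      _ = ε₀ • M + A := by
            rw [Matrix.mul_assoc, hΘ2, Matrix.mul_one, neg_mul, Matrix.mul_assoc, hΘ2,
              Matrix.mul_one, sub_neg_eq_add]
  have hRT : R₀ᵀ = Θ * (R₀ * Θ) := by
    rw [hR₀, Matrix.transpose_nonsing_inv, Matrix.transpose_sub, Matrix.transpose_smul, hM, hA,
      sub_neg_eq_add, ← hconj, Matrix.mul_inv_rev, Matrix.mul_inv_rev, hΘinv]
  have hRTj : R₀ᵀ *ᵥ j = -(Θ *ᵥ (R₀ *ᵥ j)) := by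
    rw [hRT, ← Matrix.mulVec_mulVec, ← Matrix.mulVec_mulVec, hj, Matrix.mulVec_neg,
      Matrix.mulVec_neg]
  have hval : φ (-(R₀ * M * R₀)) = (Θ *ᵥ (R₀ *ᵥ j)) ⬝ᵥ (M *ᵥ (R₀ *ᵥ j)) := by
    rw [hφ, Matrix.neg_mulVec, dotProduct_neg, ← Matrix.mulVec_mulVec, ← Matrix.mulVec_mulVec,
      Matrix.dotProduct_mulVec, ← Matrix.mulVec_transpose, hRTj, neg_dotProduct, neg_neg]
  have h4 : HasDerivAt (⇑φ ∘ (Ring.inverse ∘ fun x : ℝ => x • M - A))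
      ((Θ *ᵥ (R₀ *ᵥ j)) ⬝ᵥ (M *ᵥ (R₀ *ᵥ j))) ε₀ := by
    refine h3.congr_deriv ?_
    rw [one_smul, ContinuousLinearMap.neg_apply, ContinuousLinearMap.mulLeftRight_apply, hxinv]
    exact hval
  have e1 : (⇑φ ∘ (Ring.inverse ∘ fun x : ℝ => x • M - A)) =
      fun ε : ℝ => j ⬝ᵥ ((ε • M - A)⁻¹ *ᵥ j) := by
    funext ε
    simp only [Function.comp, hφ, Matrix.nonsing_inv_eq_ringInverse]
  rw [← e1]
  exact h4

/-- **Total dissipation = Green–Kubo form** (skewness of `A`): if `(εM − A) u = j` then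
`j · u = ε (u · M u)`. With the flow equation: `f = D_even + D_odd`, `ε f' = D_even − D_odd`. -/
theorem dissipation_eq_form {n : ℕ} (A M : Matrix (Fin n) (Fin n) ℝ) (j u : Fin n → ℝ) (ε : ℝ)
    (hA : Aᵀ = -A) (hu : (ε • M - A) *ᵥ u = j) :
    j ⬝ᵥ u = ε * (u ⬝ᵥ (M *ᵥ u)) := by
  -- skewness: (A u) · u = 0
  have hskew : (A *ᵥ u) ⬝ᵥ u = 0 := by
    have h1 : u ⬝ᵥ (A *ᵥ u) = (Aᵀ *ᵥ u) ⬝ᵥ u := by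
      rw [Matrix.dotProduct_mulVec, Matrix.mulVec_transpose]
    rw [hA, Matrix.neg_mulVec, neg_dotProduct, dotProduct_comm] at h1
    linarith
  rw [← hu, Matrix.sub_mulVec, sub_dotProduct, hskew, sub_zero, Matrix.smul_mulVec,
    smul_dotProduct, dotProduct_comm, smul_eq_mul]

/-- **Dini glue (real analysis).** If a positive function `κ` on `(0, ε₁]` obeys the flow
equation `ε κ'(ε) = −α(ε) κ(ε)` with a parity asymmetry `α ≤ a`, `s ↦ a(s)/s` integrable at `0⁺`,
then `κ` is bounded on `(0, ε₁]` (indeed `κ(ε) ≤ κ(ε₁) exp ∫_ε^{ε₁} a/s`) — which, for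
`κ = κ_ε(T)` of the unique flip-steady family, is exactly the crux in the operational form
`Disproof.cruxAt_iff_bddAbove_kappa`. (`α ≤ q < 1` constant gives instead `κ = O(ε^{-q})`,
the `SubharmonicNoisyConductivity` input of the landed reduction
`vanishingNoiseBound_of_linearNoiseLocality_of_subharmonic`.) -/
theorem bddAbove_of_dini_flow (κ α a : ℝ → ℝ) (ε₁ : ℝ) (hε₁ : 0 < ε₁)
    (hpos : ∀ ε ∈ Set.Ioc 0 ε₁, 0 < κ ε)
    (hderiv : ∀ ε ∈ Set.Ioo 0 ε₁, HasDerivAt κ (-(α ε) * κ ε / ε) ε)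
    (hcont : ContinuousOn κ (Set.Ioc 0 ε₁))
    (hle : ∀ ε ∈ Set.Ioo 0 ε₁, α ε ≤ a ε) (ha : ∀ ε ∈ Set.Ioc 0 ε₁, 0 ≤ a ε)
    (hacont : ContinuousOn a (Set.Ioo 0 ε₁))
    (hint : IntegrableOn (fun s => a s / s) (Set.Ioc 0 ε₁)) :
    BddAbove (κ '' Set.Ioc 0 ε₁) := by
  set I : ℝ := ∫ s in Set.Ioc 0 ε₁, a s / s with hI
  have hInonneg : 0 ≤ I :=
    setIntegral_nonneg measurableSet_Ioc fun s hs => div_nonneg (ha s hs) hs.1.le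
  refine ⟨Real.exp (Real.log (κ ε₁) + I), ?_⟩
  rintro y ⟨ε, ⟨hε0, hεle⟩, rfl⟩
  have hκε : 0 < κ ε := hpos ε ⟨hε0, hεle⟩
  -- the key logarithmic estimate
  have key : Real.log (κ ε) ≤ Real.log (κ ε₁) + I := by
    rcases eq_or_lt_of_le hεle with h | hlt
    · subst h; linarith
    -- f := a s / s is integrable on [ε, ε₁] and continuous on (0, ε₁)
    have hsub : Set.Icc ε ε₁ ⊆ Set.Ioc 0 ε₁ := fun x hx => ⟨hε0.trans_le hx.1, hx.2⟩
    have hfint : IntegrableOn (fun s => a s / s) (Set.Icc ε ε₁) := hint.mono_set hsub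
    have hfcont : ContinuousOn (fun s => a s / s) (Set.Ioo 0 ε₁) :=
      hacont.div continuousOn_id fun x hx => ne_of_gt hx.1
    -- G u := log κ u + ∫_ε^u a/s is monotone on [ε, ε₁]
    set G : ℝ → ℝ := fun u => Real.log (κ u) + ∫ s in ε..u, a s / s with hG
    have hGcont : ContinuousOn G (Set.Icc ε ε₁) := by
      apply ContinuousOn.add
      · exact (hcont.mono hsub).log fun x hx => ne_of_gt (hpos x (hsub hx))
      · have h := intervalIntegral.continuousOn_primitive_interval' (μ := volume)
          (f := fun s => a s / s) (b₁ := ε) (b₂ := ε₁) (a := ε)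
          ((intervalIntegrable_iff_integrableOn_Icc_of_le hlt.le).mpr hfint)
          (by rw [Set.uIcc_of_le hlt.le]; exact ⟨le_rfl, hlt.le⟩)
        rwa [Set.uIcc_of_le hlt.le] at h
    have hGderiv : ∀ u ∈ Set.Ioo ε ε₁,
        HasDerivAt G (-(α u) * κ u / u / κ u + a u / u) u := by
      intro u hu
      have hu0 : 0 < u := hε0.trans hu.1
      have hu' : u ∈ Set.Ioo 0 ε₁ := ⟨hu0, hu.2⟩
      have h1 : HasDerivAt (fun x => Real.log (κ x)) (-(α u) * κ u / u / κ u) u :=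
        (hderiv u hu').log (ne_of_gt (hpos u ⟨hu0, hu.2.le⟩))
      have h2 : HasDerivAt (fun x => ∫ s in ε..x, a s / s) (a u / u) u := by
        apply intervalIntegral.integral_hasDerivAt_right
        · exact (intervalIntegrable_iff_integrableOn_Icc_of_le hu.1.le).mpr
            (hfint.mono_set (Set.Icc_subset_Icc le_rfl hu.2.le))
        · exact hfcont.stronglyMeasurableAtFilter isOpen_Ioo u hu'
        · exact hfcont.continuousAt (isOpen_Ioo.mem_nhds hu')
      exact h1.add h2
    have hGmono : MonotoneOn G (Set.Icc ε ε₁) := by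
      apply monotoneOn_of_deriv_nonneg (convex_Icc ε ε₁) hGcont
      · intro u hu
        rw [interior_Icc] at hu
        exact (hGderiv u hu).differentiableAt.differentiableWithinAt
      · intro u hu
        rw [interior_Icc] at hu
        rw [(hGderiv u hu).deriv]
        have hu0 : 0 < u := hε0.trans hu.1
        have hκu : 0 < κ u := hpos u ⟨hu0, hu.2.le⟩
        have hαa : α u ≤ a u := hle u ⟨hu0, hu.2⟩
        have : -(α u) * κ u / u / κ u + a u / u = (a u - α u) / u := by
          field_simp
          ring
        rw [this]
        exact div_nonneg (by linarith) hu0.le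
    have hGle : G ε ≤ G ε₁ := hGmono ⟨le_rfl, hlt.le⟩ ⟨hlt.le, le_rfl⟩ hlt.le
    have hG0 : G ε = Real.log (κ ε) := by simp [hG]
    have hint2 : ∫ s in ε..ε₁, a s / s ≤ I := by
      rw [intervalIntegral.integral_of_le hlt.le, hI]
      apply setIntegral_mono_set hint
      · exact ae_restrict_of_forall_mem measurableSet_Ioc fun s hs => div_nonneg (ha s hs) hs.1.le
      · exact Filter.Eventually.of_forall fun x hx => ⟨hε0.trans hx.1, hx.2⟩
    have hG1 : G ε₁ = Real.log (κ ε₁) + ∫ s in ε..ε₁, a s / s := by simp [hG]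
    linarith
  calc κ ε = Real.exp (Real.log (κ ε)) := (Real.exp_log hκε).symm
    _ ≤ Real.exp (Real.log (κ ε₁) + I) := Real.exp_le_exp.mpr key

end Summit.AtomisticToContinuum.FouriersLaw.Cruxes.VanishingNoiseBound.IdeasR2K4

end
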